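import Mathlib.Algebra.Polynomial.AlgebraMap
import Mathlib.Analysis.Polynomial.Basic
import Literature.Barriers.Parity.UniformBatemanHorn
import Literature.NumberTheory.Sieve.BatemanHornProofs
import Literature.NumberTheory.Sieve.AletheiaZomleferFukshanskyGarcia2020
import Literature.NumberTheory.Sieve.AletheiaZomleferFukshanskyGarcia2020Applications
import Literature.NumberTheory.Sieve.ParityWave0
import HarnessLib
import Summits.Parity.BatemanHorn.Theorems.LandauConjecture

/-!
# Granville's uniformity conjecture contains Bunyakovsky's conjecture (hence Landau's problem
# on primes `m² + 1`) — proofs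

Second sibling proof file of `UniformBatemanHorn.lean` (D-0014; no new definitions), next to
`UniformBatemanHornProofs.lean` (degree one: primes in all intervals `(N, N + N^η]`).

`Literature.Barriers.Parity.GranvilleUniformityConjecture` transcribes the **Conjecture** printed
at the end of A. Granville, *Unexpected irregularities in the distribution of prime numbers*
(Proc. ICM Zürich 1994, Vol. I, Birkhäuser 1995, 388–399; p. 10 of the author's version):
"Fix `ε > 0` and positive integer `k`. The asymptotic formula in Hypothesis H holds uniformly for
`x > h(F)^ε` as `h(F) → ∞`." The source prints it as a *prediction* ("However, to be safe, we
only make the following prediction: **Conjecture.**"), not as a theorem, and remarks in the same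
paragraph that "it is not known that any polynomial of degree `≥ 2` takes on infinitely many
prime values". This file PROVES that the transcribed statement (one polynomial, `k = 1`) indeed
contains that open problem, in every degree:

* `GranvilleUniformityConjecture.bunyakovskyConjecture` — the conjecture implies the tree's
  `Literature.NumberTheory.Sieve.BunyakovskyConjecture` (**parity.S09**: every irreducible
  `f ∈ ℤ[t]` of degree `≥ 1` with positive leading coefficient and no fixed prime divisor takes
  infinitely many prime values);
* `GranvilleUniformityConjecture.landauConjecture` — in particular it implies
  `Literature.NumberTheory.Sieve.LandauConjecture` (**parity.S05**, Landau 1912: `n² + 1` is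
  prime for infinitely many `n`).

Consequence for the catalogue: the named fact `GranvilleUniformityConjecture` is an OPEN
conjecture at least as strong as Bunyakovsky's conjecture; no `GranvilleUniformityConjecture_holds`
can be landed short of settling Landau's problem.

## The argument

Fix `f` as in Bunyakovsky's conjecture, of degree `d ≥ 1`, and let `C_f > 0` be its Bateman–Horn
constant (the ordered Euler product converges to a positive limit: the tree's PROVED
`Literature.NumberTheory.Sieve.exists_hasBatemanHornConst_holds`). The translates
`f_N(t) = f(t + N)` are irreducible of degree `d` (translation is a ring automorphism of `ℤ[t]`),
have the same local root counts `ω_{f_N}(p) = ω_f(p)` (translation permutes `ℤ/pℤ`), hence no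
fixed prime divisor and the same Bateman–Horn constant `C_f`, and height
`h(f_N) ≥ |f_N(0)| = |f(N)| → ∞` (positive leading coefficient). Feed `f_N` to the conjecture
with exponent `η = 1` and `ε = 1/2`: for `N` large and `x = ⌈h(f_N)⌉`,
`π_{f_N}(x) ≥ ½ · C_f · E_{f_N}(x) > 0` because `E_{f_N}(x) ≥ 1 / log|f(N + 1)| > 0`
(`f(N + 1) ≥ 2`). So some `1 ≤ n ≤ x` has `|f(n + N)|` prime, i.e. `f` takes a prime value at
an argument `> N`; `N` being arbitrary, `f` takes infinitely many prime values. For `f = t² + 1`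
this is Landau's problem.

## References

* A. Granville, *Unexpected irregularities in the distribution of prime numbers*, Proc. ICM
  Zürich 1994, Vol. I, 388–399; author's version (12 pp.) read on the page: Hypothesis H (p. 3),
  "The Maier Matrix for `π_F(y)`" and the Conjecture (p. 10).
  [cite: Granville1995Irregularities, Conjecture (p. 10)]
-/

noncomputable section

open Filter Finset Polynomial

namespace Literature.Barriers.Parity

open Literature.NumberTheory.Sieve

/-! ### Translating the variable: `f(t) ↦ f(t + c)` -/

/-- `ω_{f(t+c)}(p) = ω_f(p)` for every `p`: the residues `n mod p` with `p ∣ f(n + c)` are the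
translates by `-c` of those with `p ∣ f(n)` (for `p = 0` both counts are `0`). [folklore] -/
theorem polyRootCountMod_comp_X_add_C (f : ℤ[X]) (c : ℤ) (p : ℕ) :
    polyRootCountMod ![f.comp (X + C c)] p = polyRootCountMod ![f] p := by
  rcases Nat.eq_zero_or_pos p with rfl | hp
  · simp [polyRootCountMod]
  haveI : NeZero p := ⟨hp.ne'⟩
  set F : (ZMod p)[X] := f.map (Int.castRingHom (ZMod p)) with hF
  -- counting the `n < p` with `p ∣ f(n + t)` is counting the roots `r` of `F(r + t)` in `ZMod p`
  have hcount : ∀ t : ℤ, #((range p).filter fun n : ℕ => (p : ℤ) ∣ f.eval ((n : ℤ) + t)) =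
      #((univ : Finset (ZMod p)).filter fun r : ZMod p => F.eval (r + (t : ZMod p)) = 0) := by
    intro t
    have hev : ∀ n : ℕ, F.eval ((n : ZMod p) + (t : ZMod p)) =
        (((f.eval ((n : ℤ) + t) : ℤ)) : ZMod p) := fun n => by
      rw [hF, ← Int.cast_natCast (R := ZMod p) n, ← Int.cast_add, eval_intCast_map, eq_intCast,
        Int.cast_id]
    refine card_bij (fun (n : ℕ) _ => (n : ZMod p)) ?_ ?_ ?_
    · intro n hn
      rw [mem_filter] at hn ⊢
      refine ⟨mem_univ _, ?_⟩
      rw [hev, ZMod.intCast_zmod_eq_zero_iff_dvd]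
      exact hn.2
    · intro a ha b hb hab
      have h := congrArg ZMod.val hab
      rwa [ZMod.val_natCast_of_lt (mem_range.1 (mem_filter.1 ha).1),
        ZMod.val_natCast_of_lt (mem_range.1 (mem_filter.1 hb).1)] at h
    · intro r hr
      refine ⟨r.val, ?_, ZMod.natCast_zmod_val r⟩
      rw [mem_filter, mem_range]
      refine ⟨ZMod.val_lt r, ?_⟩
      rw [← ZMod.intCast_zmod_eq_zero_iff_dvd, ← hev, ZMod.natCast_zmod_val]
      exact (mem_filter.1 hr).2
  unfold polyRootCountMod
  simp only [Fin.prod_univ_one, Matrix.cons_val_fin_one, eval_comp, eval_add, eval_X, eval_C]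
  have h0 := hcount 0
  simp only [add_zero, Int.cast_zero] at h0
  rw [hcount c, h0]
  exact card_equiv (Equiv.addRight ((c : ℤ) : ZMod p)) fun r => by simp

/-- Translation preserves "no fixed prime divisor". [folklore] -/
theorem hasNoFixedPrimeDivisor_comp_X_add_C {f : ℤ[X]} (hf : HasNoFixedPrimeDivisor ![f])
    (c : ℤ) : HasNoFixedPrimeDivisor ![f.comp (X + C c)] := fun p hp => by
  rw [polyRootCountMod_comp_X_add_C]
  exact hf p hp

/-- Translation preserves the ordered Bateman–Horn partial products
`∏_{p ≤ x} (1 − 1/p)⁻¹ (1 − ω_f(p)/p)`. [folklore] -/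
theorem batemanHornPartial_comp_X_add_C (f : ℤ[X]) (c : ℤ) :
    batemanHornPartial ![f.comp (X + C c)] = batemanHornPartial ![f] := by
  funext x
  unfold batemanHornPartial
  simp only [polyRootCountMod_comp_X_add_C]

/-- Hence translation preserves the Bateman–Horn constant (as an ordered limit). [folklore] -/
theorem hasBatemanHornConst_comp_X_add_C_iff (f : ℤ[X]) (c : ℤ) (A : ℝ) :
    HasBatemanHornConst ![f.comp (X + C c)] A ↔ HasBatemanHornConst ![f] A := by
  unfold HasBatemanHornConst
  rw [batemanHornPartial_comp_X_add_C]

/-- Translation preserves irreducibility in `ℤ[t]` (`t ↦ t + c` is a ring automorphism,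
Mathlib's `Polynomial.algEquivAevalXAddC`). [folklore] -/
theorem irreducible_comp_X_add_C {f : ℤ[X]} (hf : Irreducible f) (c : ℤ) :
    Irreducible (f.comp (X + C c)) := by
  have h := (MulEquiv.irreducible_iff (algEquivAevalXAddC c)).2 hf
  rwa [algEquivAevalXAddC_apply, ← comp_eq_aeval] at h

/-- Translation preserves the degree. [folklore] -/
theorem natDegree_comp_X_add_C_int (f : ℤ[X]) (c : ℤ) :
    (f.comp (X + C c)).natDegree = f.natDegree := by
  rw [natDegree_comp, natDegree_X_add_C, mul_one]

/-! ### Height and growth -/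

/-- Every coefficient is bounded by Granville's height: `|cᵢ| ≤ h(f) = (∑ⱼ cⱼ²)^{1/2}`.
[folklore] -/
theorem abs_coeff_le_polyHeight (f : ℤ[X]) {i : ℕ} (hi : i ≤ f.natDegree) :
    |((f.coeff i : ℤ) : ℝ)| ≤ polyHeight f := by
  unfold polyHeight
  rw [← Real.sqrt_sq_eq_abs]
  refine Real.sqrt_le_sqrt ?_
  have hmem : i ∈ range (f.natDegree + 1) := mem_range.2 (Nat.lt_succ_of_le hi)
  exact single_le_sum (f := fun j => ((f.coeff j : ℤ) : ℝ) ^ 2) (fun j _ => sq_nonneg _) hmem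

/-- A polynomial of degree `≥ 1` with positive leading coefficient eventually exceeds any bound
at natural arguments: `f(m) ≥ B` for all `m ≥ N₀(B)`. [folklore] -/
theorem exists_forall_le_eval_of_leadingCoeff_pos {f : ℤ[X]} (hdeg : 1 ≤ f.natDegree)
    (hlc : 0 < f.leadingCoeff) (B : ℝ) :
    ∃ N₀ : ℕ, ∀ m : ℕ, N₀ ≤ m → B ≤ ((f.eval (m : ℤ) : ℤ) : ℝ) := by
  set F : ℝ[X] := f.map (Int.castRingHom ℝ) with hF
  have hinj : Function.Injective (Int.castRingHom ℝ) := RingHom.injective_int _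
  have hdegF : 0 < F.degree := by
    rw [hF, degree_map_eq_of_injective hinj]
    exact natDegree_pos_iff_degree_pos.1 hdeg
  have hlcF : 0 ≤ F.leadingCoeff := by
    rw [hF, leadingCoeff_map_of_injective hinj, eq_intCast]
    exact_mod_cast hlc.le
  have hT : Tendsto (fun m : ℕ => F.eval (m : ℝ)) atTop atTop :=
    (F.tendsto_atTop_of_leadingCoeff_nonneg hdegF hlcF).comp tendsto_natCast_atTop_atTop
  obtain ⟨N₀, hN₀⟩ := eventually_atTop.1 (hT.eventually_ge_atTop B)
  refine ⟨N₀, fun m hm => ?_⟩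
  have h2 : B ≤ F.eval (m : ℝ) := hN₀ m hm
  rw [hF, eval_natCast_map, eq_intCast] at h2
  exact h2

/-- A single polynomial satisfying the hypotheses of Bunyakovsky's conjecture (irreducible,
positive leading coefficient, for every prime `p` some value not divisible by `p`) is a
Bateman–Horn system `![f]` in the sense of the tree (`ω_f(p) < p` via
`Literature.NumberTheory.Sieve.hasNoFixedPrimeDivisor_iff_forall_exists_not_dvd`). [folklore] -/
theorem isBatemanHornSystem_of_forall_exists_not_dvd {f : ℤ[X]} (hirr : Irreducible f)
    (hlc : 0 < f.leadingCoeff) (hnd : ∀ p : ℕ, p.Prime → ∃ n : ℤ, ¬(p : ℤ) ∣ f.eval n) :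
    IsBatemanHornSystem ![f] where
  irreducible i := by
    fin_cases i
    exact hirr
  leadingCoeff_pos i := by
    fin_cases i
    exact hlc
  pairwise_not_associated := Subsingleton.pairwise
  hasNoFixedPrimeDivisor := by
    refine (hasNoFixedPrimeDivisor_iff_forall_exists_not_dvd _).2 fun p hp => ?_
    simpa only [Fin.prod_univ_one, Matrix.cons_val_fin_one] using hnd p hp

/-! ### The consequences -/

/-- **Granville's uniformity conjecture contains Bunyakovsky's conjecture.** If
`GranvilleUniformityConjecture` holds then every irreducible `f ∈ ℤ[t]` of degree `d ≥ 1` with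
positive leading coefficient and no fixed prime divisor takes prime values `f(m)`, `m ∈ ℕ`,
infinitely often (the tree's `Literature.NumberTheory.Sieve.BunyakovskyConjecture`, parity.S09).
Proof: apply the conjecture in degree `d` with `η = 1`, `ε = 1/2` to the translates
`f_N(t) = f(t + N)` — irreducible, `ω_{f_N} = ω_f` (so no fixed prime divisor and the same
Bateman–Horn constant `C_f > 0`, which exists by the proved convergence theorem
`exists_hasBatemanHornConst_holds`), `h(f_N) ≥ |f(N)| → ∞` — at `x = ⌈h(f_N)⌉`:
`π_{f_N}(x) ≥ ½ C_f E_{f_N}(x) > 0`, so `|f(n + N)|` is prime for some `n ≥ 1`. Granville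
(p. 10) notes the irony that uniformity fails at log-power scale although "it is not known that
any polynomial of degree `≥ 2` takes on infinitely many prime values"; this theorem records that
his positive conjecture would supply exactly that.
[cite: Granville1995Irregularities, Conjecture (p. 10)] -/
theorem GranvilleUniformityConjecture.bunyakovskyConjecture (h : GranvilleUniformityConjecture) :
    BunyakovskyConjecture := by
  intro f hirr hdeg hlc hnd
  have hsys : IsBatemanHornSystem ![f] := isBatemanHornSystem_of_forall_exists_not_dvd hirr hlc hnd
  obtain ⟨C₀, hC₀pos, hC₀⟩ := exists_hasBatemanHornConst_holds hsys
  obtain ⟨h₀, H⟩ := h f.natDegree hdeg 1 one_pos (1 / 2) one_half_pos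
  obtain ⟨N₀, hN₀⟩ := exists_forall_le_eval_of_leadingCoeff_pos hdeg hlc (max h₀ 2)
  refine Set.infinite_of_forall_exists_gt fun a => ?_
  obtain ⟨N, haN, hNN⟩ : ∃ N : ℕ, a ≤ N ∧ N₀ ≤ N := ⟨max a N₀, le_max_left _ _, le_max_right _ _⟩
  -- the translate `g(t) = f(t + N)`
  set g : ℤ[X] := f.comp (X + C (N : ℤ)) with hg
  have hg_eval : ∀ z : ℤ, g.eval z = f.eval (z + N) := fun z => by
    rw [hg, eval_comp, eval_add, eval_X, eval_C]
  have hdeg_g : g.natDegree = f.natDegree := natDegree_comp_X_add_C_int f _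
  have hirr_g : Irreducible g := irreducible_comp_X_add_C hirr _
  have hnfd_g : HasNoFixedPrimeDivisor ![g] :=
    hasNoFixedPrimeDivisor_comp_X_add_C hsys.hasNoFixedPrimeDivisor _
  have hC_g : HasBatemanHornConst ![g] C₀ := (hasBatemanHornConst_comp_X_add_C_iff f _ C₀).2 hC₀
  -- the values `f(N)` and `f(1 + N)` are at least `max h₀ 2`
  have hvalN : max h₀ 2 ≤ ((f.eval (N : ℤ) : ℤ) : ℝ) := hN₀ N hNN
  have hval1 : max h₀ 2 ≤ ((f.eval ((1 + N : ℕ) : ℤ) : ℤ) : ℝ) := hN₀ (1 + N) (by omega)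
  -- height: `h(g) ≥ |g(0)| = |f(N)| ≥ max h₀ 2`
  have hH : max h₀ 2 ≤ polyHeight g := by
    have h1 : ((g.coeff 0 : ℤ) : ℝ) = ((f.eval (N : ℤ) : ℤ) : ℝ) := by
      rw [coeff_zero_eq_eval_zero, hg_eval, zero_add]
    calc max h₀ 2 ≤ ((f.eval (N : ℤ) : ℤ) : ℝ) := hvalN
      _ = ((g.coeff 0 : ℤ) : ℝ) := h1.symm
      _ ≤ |((g.coeff 0 : ℤ) : ℝ)| := le_abs_self _
      _ ≤ polyHeight g := abs_coeff_le_polyHeight g (Nat.zero_le _)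
  have hheight : h₀ ≤ polyHeight g := (le_max_left _ _).trans hH
  have hhpos : 0 < polyHeight g := lt_of_lt_of_le (lt_of_lt_of_le two_pos (le_max_right h₀ 2)) hH
  -- the range `x = ⌈h(g)⌉ ≥ h(g)^1`
  set x : ℕ := ⌈polyHeight g⌉₊
  have hxge : polyHeight g ^ (1 : ℝ) ≤ (x : ℝ) := by
    rw [Real.rpow_one]
    exact Nat.le_ceil _
  have hx1 : 1 ≤ x := Nat.ceil_pos.2 hhpos
  have key := H g hdeg_g hirr_g hnfd_g hheight x hxge C₀ hC_g
  -- `E_g(x) > 0`: its `n = 1` term is `1 / log|f(1 + N)|` with `f(1 + N) ≥ 2`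
  have hE : 0 < invLogSum g x := by
    have hmem : 1 ∈ Icc 1 x := mem_Icc.2 ⟨le_rfl, hx1⟩
    have h2v : (2 : ℝ) ≤ (((g.eval ((1 : ℕ) : ℤ)).natAbs : ℕ) : ℝ) := by
      rw [Nat.cast_natAbs, Int.cast_abs, hg_eval, Nat.cast_one]
      refine le_trans ?_ (le_abs_self _)
      have hc : ((1 + N : ℕ) : ℤ) = 1 + (N : ℤ) := by push_cast; ring
      rw [← hc]
      exact (le_max_right _ _).trans hval1
    have hterm : 0 < 1 / Real.log (((g.eval ((1 : ℕ) : ℤ)).natAbs : ℕ) : ℝ) :=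
      one_div_pos.2 (Real.log_pos (by linarith))
    unfold invLogSum
    exact lt_of_lt_of_le hterm (single_le_sum
      (f := fun n : ℕ => 1 / Real.log (((g.eval (n : ℤ)).natAbs : ℕ) : ℝ))
      (fun n _ => div_nonneg zero_le_one (Real.log_natCast_nonneg _)) hmem)
  -- hence `π_g(x) ≥ ½ C₀ E_g(x) > 0`
  have hπ : 0 < primeValueCount g x := by
    have hCE : 0 < C₀ * invLogSum g x := mul_pos hC₀pos hE
    have h2 := (abs_sub_le_iff.1 key).2
    have h3 : (0 : ℝ) < primeValueCount g x := by linarith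
    exact_mod_cast h3
  rw [primeValueCount] at hπ
  obtain ⟨n, hn⟩ := card_pos.1 hπ
  rw [mem_filter, mem_Icc] at hn
  obtain ⟨⟨hn1, -⟩, hpr⟩ := hn
  refine ⟨n + N, ?_, by omega⟩
  rw [Set.mem_setOf_eq, Int.prime_iff_natAbs_prime]
  have hc : ((n + N : ℕ) : ℤ) = (n : ℤ) + N := by push_cast; ring
  rwa [hc, ← hg_eval]

/-- **Hence Granville's uniformity conjecture contains Landau's problem**: it implies that
`n² + 1` is prime for infinitely many `n` (the tree's `Literature.NumberTheory.Sieve.LandauConjecture`,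
parity.S05; Landau, ICM 1912), as the case `f = t² + 1` of
`GranvilleUniformityConjecture.bunyakovskyConjecture` (`t² + 1` is irreducible, monic, and
`p ∤ 0² + 1`). So the fact recorded in `UniformBatemanHorn.lean` is not dischargeable short of
settling Landau's fourth problem. [cite: Granville1995Irregularities, Conjecture (p. 10)] -/
theorem GranvilleUniformityConjecture.landauConjecture (h : GranvilleUniformityConjecture) :
    Summit.Parity.BatemanHorn.LandauConjecture := by
  have hdeg2 : (X ^ 2 + 1 : ℤ[X]).natDegree = 2 := by
    simpa using natDegree_X_pow_add_C (n := 2) (r := (1 : ℤ))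
  have hB := h.bunyakovskyConjecture (X ^ 2 + 1) irreducible_X_sq_add_one_int
    (by rw [hdeg2]; norm_num) (isBatemanHornSystem_X_sq_add_one.leadingCoeff_pos 0)
    (fun p hp => ⟨0, fun hd => by
      rw [eval_add, eval_pow, eval_X, eval_one, zero_pow two_ne_zero, zero_add] at hd
      have h1 : (p : ℤ) = 1 := Int.eq_one_of_dvd_one (by positivity) hd
      exact hp.one_lt.ne' (by exact_mod_cast h1)⟩)
  have hset : {n : ℕ | Prime ((X ^ 2 + 1 : ℤ[X]).eval (n : ℤ))} = {n : ℕ | (n ^ 2 + 1).Prime} := by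
    ext n
    simp only [Set.mem_setOf_eq, eval_add, eval_pow, eval_X, eval_one, Int.prime_iff_natAbs_prime]
    have h1 : ((n : ℤ) ^ 2 + 1).natAbs = n ^ 2 + 1 := by
      rw [show ((n : ℤ) ^ 2 + 1) = ((n ^ 2 + 1 : ℕ) : ℤ) by push_cast; ring, Int.natAbs_natCast]
    rw [h1]
  unfold Summit.Parity.BatemanHorn.LandauConjecture
  rw [← hset]
  exact hB

end Literature.Barriers.Parity
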